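import Summits.CriticalPhenomena.PercolationContinuityZ3.Theorems.PercNearOneGluingNoHeavyLowerTailKnQuestion8CoefficientwiseCoreClassKernelMixJoinMatching

/-!
# FULL matchings imply JP (the chordless two-type conjecture in its strongest form implies the lane's target)

Support file (`--supports stmt-CriticalPhenomena-4575`, closed), prover `prim-cplus-coupling` (gen 73).  No definitions, no notations, no named facts,
no sorries; standard axioms.  Memo `prim-cplus-coupling/A5-COUPLING-gen73.md` §1.2.

CONJECTURE FULL (memo gen 73 §1.2, the chordless analogue of THEOREM A's invariant H): for two levels `D, B` (lower sets inside the demand region `G`)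
there are increasing injections `ψ₁ : D → T₁`, `ψ₂ : B → T₂` of the WHOLE levels together with an injective choice, for every coincidence `ψ₁ y₁ = ψ₂ y₂`,
of a witness in `G` above both sources.  This file records the elementary link used throughout the memo: FULL data give JP
(`JoinMatching.jp_of_matchings`) for all upper sets `A, C` with pool `G ∖ (D ∪ B)` — a witness above an exclusive source of `B` cannot lie in the lower
set `D` and vice versa, so the witnesses of the exclusive coincidences are automatically pool points (`jp_of_full`).  With `JoinMatching.x2_of_jp` this is (X2).
[cite: KozmaNitzan2024, Questions 8–9 (§5.5 p. 36) (context); Harris 1960; Kleitman 1966]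
-/

namespace Summit.CriticalPhenomena.PercolationContinuityZ3.Theorems.Coefficientwise.FullMatching

open Finset JoinMatching

variable {X : Type*} [DecidableEq X] [Preorder X]

/-- **FULL ⟹ JP.**  Increasing injections of two lower sets `D, B` into `T₁, T₂` whose coincidences (on the whole levels) are witnessed injectively in `G`
above both sources give the joint-pool inequality JP with pool `G ∖ (D ∪ B)` for all upper sets `A, C`. -/
theorem jp_of_full (G D B T1 T2 : Finset X) (ψ₁ ψ₂ w : X → X)
    (hD : IsLowerSet (D : Set X)) (hB : IsLowerSet (B : Set X))
    (h₁ : ∀ y ∈ D, y ≤ ψ₁ y ∧ ψ₁ y ∈ T1) (h₁inj : Set.InjOn ψ₁ (D : Set X))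
    (h₂ : ∀ y ∈ B, y ≤ ψ₂ y ∧ ψ₂ y ∈ T2) (h₂inj : Set.InjOn ψ₂ (B : Set X))
    (hw : ∀ y₁ ∈ D, ∀ y₂ ∈ B, ψ₁ y₁ = ψ₂ y₂ → y₁ ≤ w (ψ₁ y₁) ∧ y₂ ≤ w (ψ₁ y₁) ∧ w (ψ₁ y₁) ∈ G)
    (hwinj : Set.InjOn w ((D.image ψ₁ ∩ B.image ψ₂ : Finset X) : Set X))
    (A C : Finset X) (hA : IsUpperSet (A : Set X)) (hC : IsUpperSet (C : Set X)) :
    (A ∩ (D \ B)).card + (C ∩ (B \ D)).card ≤ ((A ∩ T1) ∪ (C ∩ T2)).card + (A ∩ C ∩ (G \ (D ∪ B))).card := by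
  refine jp_of_matchings (D \ B) (B \ D) T1 T2 (G \ (D ∪ B)) ψ₁ ψ₂ w ?_ ?_ ?_ ?_ ?_ ?_ A C hA hC
  · intro y hy; exact h₁ y (mem_sdiff.mp hy).1
  · exact h₁inj.mono (fun y hy => mem_coe.mpr (mem_sdiff.mp (mem_coe.mp hy)).1)
  · intro y hy; exact h₂ y (mem_sdiff.mp hy).1
  · exact h₂inj.mono (fun y hy => mem_coe.mpr (mem_sdiff.mp (mem_coe.mp hy)).1)
  · intro y₁ hy₁ y₂ hy₂ he
    obtain ⟨hy₁D, hy₁B⟩ := mem_sdiff.mp hy₁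
    obtain ⟨hy₂B, hy₂D⟩ := mem_sdiff.mp hy₂
    obtain ⟨hle₁, hle₂, hG⟩ := hw y₁ hy₁D y₂ hy₂B he
    refine ⟨hle₁, hle₂, mem_sdiff.mpr ⟨hG, ?_⟩⟩
    intro hmem
    rcases mem_union.mp hmem with hwD | hwB
    · exact hy₂D (mem_coe.mp (hD hle₂ (mem_coe.mpr hwD)))
    · exact hy₁B (mem_coe.mp (hB hle₁ (mem_coe.mpr hwB)))
  · refine hwinj.mono ?_
    intro t ht
    rw [mem_coe, mem_inter] at ht ⊢
    obtain ⟨h1, h2⟩ := ht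
    obtain ⟨y₁, hy₁, e₁⟩ := mem_image.mp h1
    obtain ⟨y₂, hy₂, e₂⟩ := mem_image.mp h2
    exact ⟨mem_image.mpr ⟨y₁, (mem_sdiff.mp hy₁).1, e₁⟩, mem_image.mpr ⟨y₂, (mem_sdiff.mp hy₂).1, e₂⟩⟩

end Summit.CriticalPhenomena.PercolationContinuityZ3.Theorems.Coefficientwise.FullMatching
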